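import Summits.QuantumFields.BalabanUV.Beta.FP.HorizontalBookkeepingEndLetters
import Summits.QuantumFields.BalabanUV.Beta.FP.TruncatedZerothMoment

/-!
# `BalabanUV.Beta.FP.HorizontalBookkeepingDefectAveraged` — road «FP», N7 H-route, row H3-BOOK (a)/(b-T) junction: THE (T0)-DEFECT LETTERS BY COSET
# AVERAGING — the affine-reproduction constants `Cw` are DETERMINED by the pattern under (L1∞) (`N^d·Cw κ = Σ'_u u_κ·w u`), hence `|Cw μ| ≤ ℓ₁/N⁴` from the
# first-moment ℓ¹ LETTER alone (no sup profile), the defect bound `N⁶·|t0Defect| ≤ 16·A·(2ℓ₂ + 2ℓ₁²)` in the letter ∕ exp-weighted-ℓ¹ currencies, and the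
# exp-ℓ¹ horizontal END with `hwA`, `hU0` DISCHARGED ([folklore] lattice bookkeeping + composition BY NAME; nothing of the manuscripts)

HONEST DEPENDENCY (page 1, mandatory): continuum YM on T⁴ ⇐ BetaPertH ∧ nine spine estimates (0/9 proved); BetaPertH ⇐ (D1) ∧ (D4) ∧
CAP+tail; G-an2-4 gates asym, D1 and NE2/3/4.  HONEST FRAMING (cell contract, verbatim): «discharging `BetaPertH` makes Bałaban's UV
stability UNCONDITIONAL — a real constructive-QFT result; it is NOT the continuum limit and NOT the Clay problem.»  THIS MODULE is the kernel form of
the cross-read finding F-ne9leaf08g27-1 (GAPS § C-ne9leaf08g27-1) on leaf-02-g6's `FP/HorizontalBookkeepingDefectLetters` (p232445): that file's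
`abs_affineConst_le` bounds `|Cw μ| ≤ c_C/N⁴` from the p = 5 SUP profile `|w x| ≤ (c/N⁵)e^{−(δ/N)|x|₁}` (row IPROF-UNIF's located, not landed, power);
but the tree's (L1∞) `DecimatedMomentSummable.LinReproSum N w Cw` says that EVERY residue class mod `N` has the SAME first moment `Cw κ`, so summing
over the `N^d` classes (`DressedMomentNormalisation.sum_cosetInd_resSite`, exactly as in `hasSum_total_of_constReproSum`) gives the total first moment:
the constants are determined by `w` and bounded by the ℓ¹ letter `Σ'(|x|₁+1)|w x| ≤ ℓ₁` divided by `N⁴` — the same constant (`c_C = ℓ₁`), no pointwise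
profile.  Consequently the `hU0` input (and `hwA : AbsMoment₂`) of leaf-02-g6's `FP/HorizontalBookkeepingEndLetters.abs_secondMoment_sub_window_le_of_expL1`
(p233197) is supplied in ITS OWN currency — the exp-weighted ℓ¹ mass `Σ' e^{(δ/N)|x|₁}|w κ l x| ≤ c/N` that gan24-leaf-04's IPROF-UNIF route (γ) delivers —
via leaf-02-g6's `FP/HorizontalBookkeepingTailLetters.letter_of_expL1` (k = 1, 2) and leaf-05-g8's `FP/TruncatedZerothMoment.abs_tsum_truncK_le_of_hasSum_zero`
(A := 40·C from the Ward letter `HasSum (K c e) 0`), composed BY NAME.  Every analytic input (kernel letters, transport letters, (H1), `hgerm`) stays a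
displayed HYPOTHESIS; this file cites nothing, defines nothing, mints no `Prop` fact, 0 sorry.  NOT hbook-discharged, NOT `hasym`, NOT D1, NOT BetaPertH,
NOT continuum, NOT Clay.

ABSOLUTE RULE (cell charter, verbatim): «No internally-minted statement may enter as a cited fact. Every hypothesis is either kernel-proved in this
package or a verbatim quotation of a PUBLISHED theorem with page reference. The manuscript(s) under audit are NOT citable for their own disputed
steps — they are the thing under adjudication; programme-internal (2001/route/tribunal) claims are never citable.»  (Nothing is cited here.)

CONTENT.
* §1 **`hasSum_first_of_linReproSum`** (any `d`): `LinReproSum N w C ⟹ HasSum (u ↦ u_κ • w u) (N^d · C κ)`, `affineConst_eq_total_first`,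
  `affineConst_unique` (the (L1∞) constants are not free data); **`abs_affineConst_le_of_letter`** (`d = 4`): `|Cw μ| ≤ ℓ₁/N⁴`.
* §2 `absMoment₂_of_weightTwo`, **`pow_six_mul_abs_t0Defect_le_of_letters`** (`N⁶|t0Defect N w T Cw κ l a b| ≤ 16A(2ℓ₂ + 2ℓ₁ℓ₁)` from `Σ'(|x|₁+1)|w| ≤ ℓ₁`,
  `Σ'(|x|₁+1)²|w| ≤ ℓ₂·N`, `|Σ'T c e| ≤ A/N²` — g5's `HorizontalBookkeeping.pow_six_mul_abs_t0Defect_le` BY NAME), `absMoment₂_of_expL1`,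
  **`pow_six_mul_abs_t0Defect_le_of_expL1`** (`… ≤ 16A(2·(2ce^δ/δ²) + 2(ce^δ/δ)²)`).
* §3 **`abs_secondMoment_sub_window_le_of_expL1_letters`** — the exp-ℓ¹ END from NAMED LETTERS ONLY: leaf-05-g8's `HorizontalBookkeepingLetters.…_of_supProfile`
  binder list with the sup profile `hw` REPLACED by `hwE`/`hwEb` (and `hwA` dropped — it follows), conclusion `≤ U₀ᴱ + 161·A_E + (3·Cg + 67392·C) + |c₀|`,
  `U₀ᴱ := 16·(40C)·(2·(2ce^δ/δ²) + 2·(ce^δ/δ)²)`, N-UNIFORM.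
Unit `b2b-balaban-t4-ne9-formalise-leaf-08` (gen 27; NE9 formalisation swarm, cross-row idle-seat station NE9 → road FP).
-/

noncomputable section

namespace Summit.QuantumFields.BalabanUV.Beta.FP.HorizontalBookkeepingDefectAveraged

open Finset Filter Topology
open scoped BigOperators
open Literature.Probability.LatticeModels (box annulus)
open Literature.MathematicalPhysics.QuantumFieldTheory.Balaban1983to89
open Literature.MathematicalPhysics.QuantumFieldTheory.Balaban1983to89.Beta
open B12Sec2to5 (l1 l1_nonneg abs_coord_le_l1)
open DyadicShell (Pt supNorm)
open DecimatedMoment (cosetInd)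
open DecimatedMomentSummable (ConstReproSum LinReproSum AbsMoment₂)
open DressedMomentNormalisation (EKer dressedEntry resSite sum_cosetInd_resSite)
open Summit.QuantumFields.BalabanUV.Beta.FP.HorizontalBookkeeping (truncK t0Defect pow_six_mul_abs_t0Defect_le)
open Summit.QuantumFields.BalabanUV.Beta.FP.HorizontalBookkeepingTail (nonneg_of_decay)
open Summit.QuantumFields.BalabanUV.Beta.FP.HorizontalBookkeepingTailLetters (letter_of_expL1)
open Summit.QuantumFields.BalabanUV.Beta.FP.HorizontalBookkeepingEndLetters (abs_secondMoment_sub_window_le_of_expL1)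
open Summit.QuantumFields.BalabanUV.Beta.FP.TruncatedZerothMoment (abs_tsum_truncK_le_of_hasSum_zero)

/-! ## §1 Coset averaging: the affine constants from the first-moment letter -/

/-- [folklore] **TOTAL FIRST MOMENT FROM (L1∞)**: under `LinReproSum N w C` (every residue-class first-moment family sums to the SAME `C κ`) the full
first-moment family `u ↦ u_κ • w u` has the sum `N^d · C κ` — the `LinReproSum` twin of `DressedMomentNormalisation.hasSum_total_of_constReproSum`
(sum the `N^d` coset families; `Σ_r cosetInd N (resSite r − u) = 1`).  In particular the affine constants are DETERMINED by `w`. -/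
theorem hasSum_first_of_linReproSum {d N : ℕ} (hN : 0 < N) {w : (Fin d → ℤ) → ℝ} {C : Fin d → ℝ}
    (h : LinReproSum N w C) (κ : Fin d) :
    HasSum (fun u => u κ • w u) ((N : ℝ) ^ d * C κ) := by
  have hs := hasSum_sum (s := (Finset.univ : Finset (Fin d → Fin N)))
    (f := fun r u => (cosetInd N (resSite r - u) * u κ) • w u) (a := fun _ => C κ) (fun r _ => h (resSite r) κ)
  have hcard : ∑ _r : Fin d → Fin N, C κ = (N : ℝ) ^ d * C κ := by
    rw [Finset.sum_const, Finset.card_univ, Fintype.card_pi, Finset.prod_const, Finset.card_univ, Fintype.card_fin,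
      Fintype.card_fin, nsmul_eq_mul, Nat.cast_pow]
  rw [hcard] at hs
  refine hs.congr_fun (fun u => ?_)
  rw [← Finset.sum_smul, ← Finset.sum_mul, sum_cosetInd_resSite hN u, one_mul]

/-- [folklore] Hence the (L1∞) constants are NOT free data: `C κ = (N^d)⁻¹ · Σ'_u u_κ • w u` (`0 < N`). -/
theorem affineConst_eq_total_first {d N : ℕ} (hN : 0 < N) {w : (Fin d → ℤ) → ℝ} {C : Fin d → ℝ}
    (h : LinReproSum N w C) (κ : Fin d) :
    C κ = ((N : ℝ) ^ d)⁻¹ * ∑' u, u κ • w u := by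
  have hX : (0 : ℝ) < (N : ℝ) ^ d := by positivity
  rw [(hasSum_first_of_linReproSum hN h κ).tsum_eq, ← mul_assoc, inv_mul_cancel₀ hX.ne', one_mul]

/-- [folklore] … and two (L1∞) constant vectors of the same pattern COINCIDE. -/
theorem affineConst_unique {d N : ℕ} (hN : 0 < N) {w : (Fin d → ℤ) → ℝ} {C C' : Fin d → ℝ}
    (h : LinReproSum N w C) (h' : LinReproSum N w C') : C = C' := by
  funext κ
  rw [affineConst_eq_total_first hN h κ, affineConst_eq_total_first hN h' κ]

/-- **THE AFFINE-REPRODUCTION CONSTANTS ARE `O(N⁻⁴)` FROM THE FIRST-MOMENT LETTER ALONE**: `LinReproSum N w Cw`, `Σ'(|x|₁+1)|w x| ≤ ℓ₁` (summable),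
`N ≥ 1` ⟹ `|Cw μ| ≤ ℓ₁/N⁴`.  (`HorizontalBookkeepingDefectLetters.abs_affineConst_le` reaches the same constant `ℓ₁ = c·e^{δ/2}(2/δ)(1+4/δ)⁴` from the
pointwise sup profile; none is needed.) [folklore] -/
theorem abs_affineConst_le_of_letter {w : Pt → ℝ} {Cw : Fin 4 → ℝ} {ℓ₁ : ℝ} {N : ℕ} (hN : 1 ≤ N)
    (hw1 : LinReproSum N w Cw) (hwS : Summable fun x => (l1 x + 1) * |w x|)
    (hL1 : ∑' x, (l1 x + 1) * |w x| ≤ ℓ₁) (μ : Fin 4) :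
    |Cw μ| ≤ ℓ₁ / (N : ℝ) ^ 4 := by
  have hN0 : 0 < N := hN
  have h := hasSum_first_of_linReproSum hN0 hw1 μ
  have hX : (0 : ℝ) < (N : ℝ) ^ 4 := by positivity
  rw [le_div_iff₀ hX]
  have e : |Cw μ| * (N : ℝ) ^ 4 = |∑' u : Pt, u μ • w u| := by
    rw [h.tsum_eq, abs_mul, abs_of_pos hX, mul_comm]
  rw [e]
  have hpt : ∀ u : Pt, ‖u μ • w u‖ ≤ (l1 u + 1) * |w u| := by
    intro u
    rw [zsmul_eq_mul, Real.norm_eq_abs, abs_mul]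
    exact mul_le_mul_of_nonneg_right ((abs_coord_le_l1 u μ).trans (by linarith)) (abs_nonneg _)
  have h1 : ‖∑' u : Pt, u μ • w u‖ ≤ ∑' u : Pt, (l1 u + 1) * |w u| := tsum_of_norm_bounded hwS.hasSum hpt
  rw [Real.norm_eq_abs] at h1
  exact h1.trans hL1

/-! ## §2 The (T0)-defect bound in the letter and exp-weighted ℓ¹ currencies -/

/-- [folklore] The weight-`(|x|₁+1)²` letter dominates `AbsMoment₂` (`1 + |x|₁² ≤ (|x|₁+1)²`). -/
theorem absMoment₂_of_weightTwo {w : Pt → ℝ} (hwS : Summable fun x => (l1 x + 1) ^ 2 * |w x|) : AbsMoment₂ w := by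
  refine Summable.of_nonneg_of_le (fun x => mul_nonneg (by positivity) (abs_nonneg _)) (fun x => ?_) hwS
  have h0 := l1_nonneg x
  exact mul_le_mul_of_nonneg_right (by nlinarith) (abs_nonneg _)

/-- [folklore] The weight-`(|x|₁+1)` family is summable when the weight-`(|x|₁+1)²` family is. -/
theorem summable_weightOne_of_weightTwo {w : Pt → ℝ} (hwS : Summable fun x => (l1 x + 1) ^ 2 * |w x|) :
    Summable fun x => (l1 x + 1) * |w x| := by
  refine Summable.of_nonneg_of_le (fun x => mul_nonneg (by linarith [l1_nonneg x]) (abs_nonneg _)) (fun x => ?_) hwS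
  have h1 : (1 : ℝ) ≤ l1 x + 1 := by linarith [l1_nonneg x]
  exact mul_le_mul_of_nonneg_right (by nlinarith) (abs_nonneg _)

/-- **THE (T0)-DEFECT BOUND IN THE LETTER CURRENCY** (no sup profile): (L1∞) constants `Cw`, letters `Σ'(|x|₁+1)|w κ l x| ≤ ℓ₁` and
`Σ'(|x|₁+1)²|w κ l x| ≤ ℓ₂·N` (summable), a middle factor with `|Σ'_t T c e t| ≤ A/N²` (`N ≥ 1`) ⟹ `N⁶·|t0Defect N w T Cw κ l a b| ≤ 16·A·(2ℓ₂ + 2ℓ₁·ℓ₁)`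
— `HorizontalBookkeeping.pow_six_mul_abs_t0Defect_le` with `hB2 ≤ ℓ₂·N`, `hB1 ≤ ℓ₁`, `hBC ≤ ℓ₁/N⁴` (§1). [folklore] -/
theorem pow_six_mul_abs_t0Defect_le_of_letters {w T : EKer 4} {Cw : Fin 4 → Fin 4 → Fin 4 → ℝ} {ℓ₁ ℓ₂ A : ℝ} {N : ℕ}
    (hN : 1 ≤ N) (hw1 : ∀ κ l, LinReproSum N (w κ l) (Cw κ l))
    (hwS : ∀ κ l, Summable fun x => (l1 x + 1) ^ 2 * |w κ l x|)
    (hL1 : ∀ κ l, ∑' x, (l1 x + 1) * |w κ l x| ≤ ℓ₁) (hL2 : ∀ κ l, ∑' x, (l1 x + 1) ^ 2 * |w κ l x| ≤ ℓ₂ * N)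
    (hA : ∀ c' e, |∑' t, T c' e t| ≤ A / (N : ℝ) ^ 2) (κ l a b : Fin 4) :
    (N : ℝ) ^ 6 * |t0Defect N w T Cw κ l a b| ≤ 16 * A * (2 * ℓ₂ + 2 * ℓ₁ * ℓ₁) := by
  have hN0 : 0 < N := hN
  have hwS1 : ∀ κ' l', Summable fun x => (l1 x + 1) * |w κ' l' x| := fun κ' l' => summable_weightOne_of_weightTwo (hwS κ' l')
  have hB2 : ∀ c' e, |∑' x, (x κ * x l) • w c' e x| ≤ ℓ₂ * N := by
    intro c' e
    have hpt : ∀ x : Pt, ‖(x κ * x l) • w c' e x‖ ≤ (l1 x + 1) ^ 2 * |w c' e x| := by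
      intro x
      rw [zsmul_eq_mul, Real.norm_eq_abs, abs_mul, Int.cast_mul, abs_mul]
      refine mul_le_mul_of_nonneg_right ?_ (abs_nonneg _)
      have h1 := abs_coord_le_l1 x κ; have h2 := abs_coord_le_l1 x l; have h0 := l1_nonneg x
      nlinarith [mul_le_mul h1 h2 (abs_nonneg _) h0, abs_nonneg (x κ : ℝ)]
    have h1 : ‖∑' x : Pt, (x κ * x l) • w c' e x‖ ≤ ∑' x : Pt, (l1 x + 1) ^ 2 * |w c' e x| :=
      tsum_of_norm_bounded (hwS c' e).hasSum hpt
    rw [Real.norm_eq_abs] at h1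
    exact h1.trans (hL2 c' e)
  have hB1 : ∀ c' e (μ : Fin 4), |∑' x, x μ • w c' e x| ≤ ℓ₁ := by
    intro c' e μ
    have hpt : ∀ x : Pt, ‖x μ • w c' e x‖ ≤ (l1 x + 1) * |w c' e x| := by
      intro x
      rw [zsmul_eq_mul, Real.norm_eq_abs, abs_mul]
      exact mul_le_mul_of_nonneg_right ((abs_coord_le_l1 x μ).trans (by linarith)) (abs_nonneg _)
    have h1 : ‖∑' x : Pt, x μ • w c' e x‖ ≤ ∑' x : Pt, (l1 x + 1) * |w c' e x| :=
      tsum_of_norm_bounded (hwS1 c' e).hasSum hpt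
    rw [Real.norm_eq_abs] at h1
    exact h1.trans (hL1 c' e)
  have hBC : ∀ c' e (μ : Fin 4), |Cw c' e μ| ≤ ℓ₁ / (N : ℝ) ^ 4 := fun c' e μ =>
    abs_affineConst_le_of_letter hN (hw1 c' e) (hwS1 c' e) (hL1 c' e) μ
  exact pow_six_mul_abs_t0Defect_le hN0 w T Cw κ l a b hA hB2 hB1 hBC

/-- [folklore] The exponentially weighted ℓ¹ mass `Σ'_x e^{(δ/N)|x|₁}|w x| ≤ c/N` (summable, `δ > 0`, `N ≥ 1`) gives `AbsMoment₂ w`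
(`HorizontalBookkeepingTailLetters.letter_of_expL1` at `k = 2`). -/
theorem absMoment₂_of_expL1 {w : Pt → ℝ} {c δ : ℝ} {N : ℕ} (hδ : 0 < δ) (hN : 1 ≤ N)
    (hs : Summable fun x => Real.exp (δ / N * l1 x) * |w x|) (hb : ∑' x, Real.exp (δ / N * l1 x) * |w x| ≤ c / N) :
    AbsMoment₂ w :=
  absMoment₂_of_weightTwo (letter_of_expL1 (D := 4) hδ hN hs hb 2).1

/-- **THE (T0)-DEFECT BOUND IN THE EXPONENTIALLY WEIGHTED ℓ¹ CURRENCY**: (L1∞) constants `Cw`, `Σ'_x e^{(δ/N)|x|₁}|w κ l x| ≤ c/N` (summable, `δ > 0`),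
`|Σ'_t T c e t| ≤ A/N²` (`N ≥ 1`) ⟹ `N⁶·|t0Defect N w T Cw κ l a b| ≤ 16·A·(2·(2c·e^δ/δ²) + 2·(c·e^δ/δ)·(c·e^δ/δ))` — §2 at the letters
`ℓ₁ = c·e^δ/δ`, `ℓ₂ = 2c·e^δ/δ²` of `letter_of_expL1` (`k = 1, 2`); FREE OF `N`, no sup profile. [folklore] -/
theorem pow_six_mul_abs_t0Defect_le_of_expL1 {w T : EKer 4} {Cw : Fin 4 → Fin 4 → Fin 4 → ℝ} {c δ A : ℝ} {N : ℕ}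
    (hN : 1 ≤ N) (hδ : 0 < δ) (hw1 : ∀ κ l, LinReproSum N (w κ l) (Cw κ l))
    (hwE : ∀ κ l, Summable fun x => Real.exp (δ / N * l1 x) * |w κ l x|)
    (hwEb : ∀ κ l, ∑' x, Real.exp (δ / N * l1 x) * |w κ l x| ≤ c / N)
    (hA : ∀ c' e, |∑' t, T c' e t| ≤ A / (N : ℝ) ^ 2) (κ l a b : Fin 4) :
    (N : ℝ) ^ 6 * |t0Defect N w T Cw κ l a b|
      ≤ 16 * A * (2 * (2 * c * Real.exp δ / δ ^ 2) + 2 * (c * Real.exp δ / δ) * (c * Real.exp δ / δ)) := by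
  have hN' : (1 : ℝ) ≤ N := by exact_mod_cast hN
  have hX : (0 : ℝ) < N := by linarith
  have hwS : ∀ κ' l', Summable fun x => (l1 x + 1) ^ 2 * |w κ' l' x| := fun κ' l' =>
    (letter_of_expL1 (D := 4) hδ hN (hwE κ' l') (hwEb κ' l') 2).1
  have hL1 : ∀ κ' l', ∑' x, (l1 x + 1) * |w κ' l' x| ≤ c * Real.exp δ / δ := by
    intro κ' l'
    have h := (letter_of_expL1 (D := 4) hδ hN (hwE κ' l') (hwEb κ' l') 1).2
    simp only [pow_one, Nat.factorial_one, Nat.cast_one, one_mul] at h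
    refine h.trans (le_of_eq ?_)
    field_simp
  have hL2 : ∀ κ' l', ∑' x, (l1 x + 1) ^ 2 * |w κ' l' x| ≤ 2 * c * Real.exp δ / δ ^ 2 * N := by
    intro κ' l'
    have h := (letter_of_expL1 (D := 4) hδ hN (hwE κ' l') (hwEb κ' l') 2).2
    have e2 : ((Nat.factorial 2 : ℕ) : ℝ) = 2 := by norm_num [Nat.factorial]
    rw [e2] at h
    refine h.trans (le_of_eq ?_)
    field_simp
  exact pow_six_mul_abs_t0Defect_le_of_letters hN hw1 hwS hL1 hL2 hA κ l a b

/-! ## §3 The exp-weighted ℓ¹ horizontal END from named letters only -/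

/-- **THE HORIZONTAL BOOKKEEPING BOUND IN THE exp-ℓ¹ TRANSPORT CURRENCY, FROM THE NAMED LETTERS AND NOTHING ELSE**: kernel letters (sextic decay, septic
differences, evenness, the Ward ∕ (T0) letter `HasSum (K c e) 0`), transport letters (Kronecker masses (L0∞), (L1∞) constants `Cw`, the exp-weighted ℓ¹
mass `Σ'_x e^{(δ/N)|x|₁}|w κ l x| ≤ c/N`), (H1) at kernel level, the log-asymptotics `hgerm` ⟹ for every `N ≥ 1`
`|secondMoment T μ ν − Σ_{0<‖z‖∞≤N} K μ ν z·z_μ·z_ν| ≤ U₀ᴱ + 161·A_E + (3·Cg + 67392·C) + |c₀|` with the DISPLAYED N-free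
`U₀ᴱ := 16·(40C)·(2·(2ce^δ/δ²) + 2·(ce^δ/δ)²)` and leaf-02-g6's `A_E` — `HorizontalBookkeepingEndLetters.abs_secondMoment_sub_window_le_of_expL1` with its
`hwA` (`absMoment₂_of_expL1`) and `hU0` (`pow_six_mul_abs_t0Defect_le_of_expL1` fed by `TruncatedZerothMoment.abs_tsum_truncK_le_of_hasSum_zero`, A := 40C)
DISCHARGED; the twin of leaf-05-g8's `HorizontalBookkeepingLetters.abs_secondMoment_sub_window_le_of_supProfile` with NO sup profile. [folklore] -/
theorem abs_secondMoment_sub_window_le_of_expL1_letters {K w : EKer 4} {C c δ : ℝ} {N : ℕ} (hN : 1 ≤ N) (hδ : 0 < δ)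
    -- kernel letters (incl. the Ward ∕ (T0) letter of the FULL kernel)
    (hK : ∀ c' e (t : Pt), |K c' e t| ≤ C / ((supNorm t : ℝ) + 1) ^ 6)
    (hdK : ∀ c' e (t : Pt) (i : Fin 4), |K c' e (t + Pi.single i 1) - K c' e t| ≤ C / ((supNorm t : ℝ) + 1) ^ 7)
    (heven : ∀ c' e (t : Pt), K c' e (-t) = K c' e t)
    (hK0 : ∀ c' e, HasSum (K c' e) 0)
    -- transport letters
    (Cw : Fin 4 → Fin 4 → Fin 4 → ℝ)
    (hw0 : ∀ κ l, ConstReproSum N (w κ l) (if κ = l then (((N : ℝ) ^ (4 + 1))⁻¹) else 0))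
    (hw1 : ∀ κ l, LinReproSum N (w κ l) (Cw κ l))
    (hwE : ∀ κ l, Summable fun x => Real.exp (δ / N * l1 x) * |w κ l x|)
    (hwEb : ∀ κ l, ∑' x, Real.exp (δ / N * l1 x) * |w κ l x| ≤ c / N)
    -- (H1) at kernel level for the transported kernel, channel `(μ, ν)`
    {T D : EKer 4} (μ ν : Fin 4)
    (hH1 : ∀ v : Pt, (N : ℝ) ^ 8 * dressedEntry w K ((N : ℤ) • v) μ ν = T μ ν v + K μ ν v + D μ ν v)
    (hT : Summable fun v : Pt => T μ ν v * (v μ : ℝ) * (v ν : ℝ))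
    (hD : HasSum (fun v : Pt => D μ ν v * (v μ : ℝ) * (v ν : ℝ)) 0)
    -- the log-asymptotics letter of the window function
    {s c₀ Cg : ℝ}
    (hgerm : ∀ M : ℕ, 1 ≤ M → |∑ z ∈ annulus 4 0 M, K μ ν z * (z μ : ℝ) * (z ν : ℝ) - (s * Real.log M + c₀)| ≤ Cg) :
    let U₀E : ℝ := 16 * (40 * C) * (2 * (2 * c * Real.exp δ / δ ^ 2) + 2 * (c * Real.exp δ / δ) * (c * Real.exp δ / δ))
    let AE : ℝ := (4 : ℝ) ^ 7 * (16 * C * (c * Real.exp δ) ^ 2 + C)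
        + (5 / 4 : ℝ) ^ 7 * (C * (c * Real.exp δ) * (128 * (4 / 3 : ℝ) ^ 7 * (c * Real.exp δ / δ) + 4096 * 16 ^ 7 * (5040 * c * Real.exp δ / δ ^ 7)))
    |B12Beta.secondMoment T μ ν - ∑ z ∈ annulus 4 0 N, K μ ν z * (z μ : ℝ) * (z ν : ℝ)|
      ≤ U₀E + 161 * AE + (3 * Cg + 67392 * C) + |c₀| := by
  intro U₀E AE
  have hC : 0 ≤ C := nonneg_of_decay hK μ ν
  -- the (T0)-smallness of the truncation from the Ward letter, then the defect size in the exp-ℓ¹ currency (§2) and `AbsMoment₂`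
  have hA : ∀ c' e, |∑' t : Pt, truncK K N c' e t| ≤ 40 * C / (N : ℝ) ^ 2 :=
    fun c' e => abs_tsum_truncK_le_of_hasSum_zero hC c' e (hK c' e) (hK0 c' e) hN
  have hwA : ∀ κ l, AbsMoment₂ (w κ l) := fun κ l => absMoment₂_of_expL1 hδ hN (hwE κ l) (hwEb κ l)
  have hU0 : (N : ℝ) ^ 6 * |t0Defect N w (truncK K N) Cw μ ν μ ν| ≤ U₀E :=
    pow_six_mul_abs_t0Defect_le_of_expL1 hN hδ hw1 hwE hwEb hA μ ν μ ν
  exact abs_secondMoment_sub_window_le_of_expL1 hN hδ hK hdK heven Cw hw0 hw1 hwA hwE hwEb μ ν hH1 hT hD hU0 hgerm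

end Summit.QuantumFields.BalabanUV.Beta.FP.HorizontalBookkeepingDefectAveraged

end
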